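import Summits.BirchSwinnertonDyer.Rank1Residual.Additive.KatoDescentRankOneCountContraOfFacts
import HarnessLib

set_option autoImplicit false

/-!
# `ℤ_p`-homogeneity of the Kummer logarithm `HasLocPKummerLog` — display (5) LOG-HOM of
# `KatoDescentRankOneCountContraOfFacts.lean` PROVED: `c₁ • x = c₂ • y`, `log loc_p x = s`, `log loc_p y = t`
# ⟹ `c₁ s = c₂ t`; stub 3 `stub_rankOneCountReadingKato` now rests on three named facts + THREE displays
# (seat `bsd-cm-prr-ty1` g7, cell `bsd-cm`, planner D423 item K2; theorems only: no definition, no named fact,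
# no instance, no `sorry`)

Part 3 of the seat's kernel cut of stub 3 of the Kato–Perrin-Riou skeletons v4 (cruxes stmt-BirchSwinnertonDyer-19945
`…/Lines/kato_perrin_riou_zp.lean`, stmt-BirchSwinnertonDyer-19223 `…/Lines/kato_perrin_riou_istar.lean`; = cell
bsd-potss's held input 27322): part 1 `KatoDescentRankOneCountContraCut.lean` (conjunct (i)), step K1
`Literature/…/Kato2004/AdmissibleZetaClassBottomLayerProofs.lean` ((A6′) at the bottom layer), part 2
`KatoDescentRankOneCountContraOfFacts.lean` (the whole stub from three named facts and four displayed schemata).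
Here the displayed schema (5) LOG-HOM becomes a theorem, in exactly the displayed shape (`logHom_display`).

MATHEMATICS. `HasLocPKummerLog W p x t` (bsd-smallim, `Kato2004/LocPKummerLog.lean`) says, in finite-level
currency: there are `m ≠ 0` and `Q ∈ E(ℚ_p)` with `loc_p(m • x) ≡ κ_k(Q)` in `H¹(ℚ_v, W[p^k])` for EVERY `k`
(`κ_k` the tree's local Kummer map `localKummerMap`, `v = primePlace p`, `E(ℚ_p) → E(ℚ_v)` along `ℚ_p ≅ ℚ_v`) and
`log_ω(Q) = m·t`. The logarithm `t` is then `ℤ_p`-homogeneous in `x` — the finite-level shadow of «`log :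
H¹_f(ℚ_p, V_pE) = E(ℚ_p) ⊗ ℚ_p → ℚ_p` is a homomorphism» (Bloch–Kato, Ex. 3.11) — by a levelwise approximation
argument using only tree theorems:
* §1 `loc_p mod p^k` kills `p^k·H¹(ℚ, T_pW)` (`reduceH1Pk_pow_smul`, Kato §13.8), so it sees a scalar `c ∈ ℤ_p`
  only through its digit approximation `c mod p^k ∈ ℕ` (`PadicInt.appr`);
* §2 `E(ℚ_p) → E(ℚ_v)` is onto (transport along the inverse of `Padic.adicCompletionEquiv`), and `log` is
  BOUNDED on `E(ℚ_p)` (its image is the fractional ideal `p^e ℤ_p`: cell b2b-bsdres's `range_padicLog_eq_span_zpow`,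
  AEC IV.6.4 / VII.6.3; `Kato2004.padicLogLocal = Additive.LocalLog.padicLog`, cell bsd-cn100);
* §3 at level `p^k`, with `a = c₁ mod p^k`, `b = c₂ mod p^k` and witnesses `(m, Q)`, `(n, R)`:
  `κ_k((an)·Q) = κ_k((bm)·R)`, so by the exactness of the local Kummer sequence (`ker κ_k = p^k·E(ℚ_v)`, tree
  `ker_localKummerMap`, AEC VIII.§2) `(an)·Q − (bm)·R ∈ p^k E(ℚ_p)` and `|mn·(a s − b t)| = |p^k·log S_k| ≤ C·p^{-k}`;
  as `|c₁ − a|, |c₂ − b| ≤ p^{-k}`, `|mn·(c₁ s − c₂ t)| ≤ C'·p^{-k}` for every `k`, i.e. `c₁ s = c₂ t`.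
  Corollaries: uniqueness of the Kummer logarithm (`HasLocPKummerLog.unique`) and «a `ℤ_p`-torsion class has
  logarithm `0`» (`HasLocPKummerLog.eq_zero_of_smul_eq_zero`);
* §4 `rankOneCountReading_contra_of_facts_of_logHom`: stub 3 (verbatim type) from {GZK,
  `Kato2004.finite_descentCokernel_of_rankOne`, `IsNewformOf.level_eq_conductorNorm`} and the three remaining displays
  LOG-EX (4), PR-INV (6), COUNT (7) — RESIDUAL OF STUB 3 after this file.

HONEST LABEL: §1–§3 are unconditional theorems about the tree's objects; §4 is a conditional reduction on displayed
hypotheses; no stub or item is closed; nothing is registered; nothing is asserted on 19945 / 19223; Kato's Main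
Conjecture and Perrin-Riou's conjecture are not touched; BSD is not proved for any curve.

References: [BlochKato1990] Def. 3.10, Ex. 3.11; [SilvermanAEC2009] IV.6.4, VII.6.3, VIII.§2, X.§4 (**);
[Kato2004Asterisque] §13.8 (p. 228), §14.14 (p. 243), Prop. 14.16 (p. 244); [AlpogeBhargavaShnidman2022] App. A §10.1.2
and Thm. 10.8 (a) (p. 33); [NeukirchANT1999] Ch. II §2.
-/

noncomputable section

open scoped Classical NumberField

open WeierstrassCurve Field IsDedekindDomain CategoryTheory Literature.NumberTheory.EllipticCurves
  Literature.NumberTheory.EllipticCurves.ModularForms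
  Literature.NumberTheory.EllipticCurves.Rank1Residual Literature.NumberTheory.EllipticCurves.Rank1Residual.Typed
  Literature.NumberTheory.EllipticCurves.Kato2004 Literature.NumberTheory.EllipticCurves.Kato2004.EulerSystemValues
  Literature.NumberTheory.EllipticCurves.IwasawaAlgebra Literature.NumberTheory.GaloisRepresentations
open Summit.BirchSwinnertonDyer.BirchSwinnertonDyer.Theorems.CongruentShaFreeCutKatoKummerLogTorsion

namespace Summit.BirchSwinnertonDyer.Rank1Residual.Additive.ContraCount

/-! ## §1 Level `p^k`: `loc_p mod p^k` only sees a `p`-adic scalar through its `k`-th digit approximation -/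

section Level

variable (W : WeierstrassCurve ℚ) [W.IsElliptic] (p : ℕ) [Fact p.Prime]
  [ContinuousSMul ℤ_[p] (W.tateModule p)]

/-- `loc_p mod p^k` kills `p^k`-multiples (the coefficients `W[p^k]` are killed by `p^k`,
`reduceH1Pk_pow_smul`). [cite: Kato2004Asterisque, §13.8 (p. 228)] -/
theorem locModPk_pow_smul (k : ℕ) (z : H1 (tateRep W p) ⊤) :
    locModPk W p k (((p : ℤ_[p]) ^ k) • z) = 0 := by
  rw [locModPk_apply, reduceH1Pk_pow_smul, map_zero]
  exact map_zero _

/-- **`loc_p(c • z) ≡ loc_p(a • z) (mod p^k)`** for the integer `a = c mod p^k` (`PadicInt.appr c k`):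
`c - a ∈ p^k ℤ_p` and `loc_p mod p^k` is additive and kills `p^k`-multiples. [cite: Kato2004Asterisque, §13.8 (p. 228)] -/
theorem locModPk_smul_eq_locModPk_appr_smul (k : ℕ) (c : ℤ_[p]) (z : H1 (tateRep W p) ⊤) :
    locModPk W p k (c • z) = locModPk W p k (c.appr k • z) := by
  obtain ⟨r, hr⟩ := Ideal.mem_span_singleton'.mp (PadicInt.appr_spec k c)
  have hc : c • z = ((c.appr k : ℕ) : ℤ_[p]) • z + ((p : ℤ_[p]) ^ k) • (r • z) := by
    rw [smul_smul, ← add_smul, mul_comm, hr, add_sub_cancel]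
  rw [hc, map_add, locModPk_pow_smul, add_zero, Nat.cast_smul_eq_nsmul]

end Level

/-! ## §2 The local side: `E(ℚ_p) → E(ℚ_v)` is onto, and `log` is bounded on `E(ℚ_p)` -/

section Local

variable (W : WeierstrassCurve ℚ) [W.IsElliptic] (p : ℕ) [Fact p.Prime]

omit [W.IsElliptic] in
/-- **`E(ℚ_p) → E(ℚ_v)` (`v = primePlace p`, along `padicToAdic : ℚ_p ≅ ℚ_v`) is onto**: a `ℚ_v`-point is
the image of its transport along the inverse isomorphism. [cite: NeukirchANT1999, Ch. II §2 (`ℚ_p` as a completion)] -/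
theorem exists_map_padicToAdic_eq
    (S : (W.baseChange ((primePlace p).adicCompletion ℚ)).toAffine.Point) :
    ∃ S₀ : (W.baseChange ℚ_[p]).toAffine.Point,
      WeierstrassCurve.Affine.Point.map (padicToAdic p) S₀ = S := by
  let e := Padic.adicCompletionEquiv (R := 𝓞 ℚ) ⟨p, Fact.out⟩
  let ι' : (primePlace p).adicCompletion ℚ →ₐ[ℚ] ℚ_[p] := e.symm.toAlgEquiv.toAlgHom
  have hid : (padicToAdic p).comp ι' = AlgHom.id ℚ ((primePlace p).adicCompletion ℚ) := by
    refine AlgHom.ext fun a ↦ ?_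
    rw [AlgHom.comp_apply, padicToAdic_apply]
    exact e.apply_symm_apply a
  refine ⟨WeierstrassCurve.Affine.Point.map ι' S, ?_⟩
  rw [WeierstrassCurve.Affine.Point.map_map, hid]
  cases S <;> rfl

/-- **`log` is bounded on `E(ℚ_p)`**: `‖log Q‖ ≤ C` for one real `C` and every `Q ∈ E(ℚ_p)` — the image
of `log` is the fractional ideal `p^e ℤ_p` (tree `range_padicLog_eq_span_zpow`, AEC IV.6.4 / VII.6.3).
[cite: SilvermanAEC2009, IV.6.4 and VII.6.3] -/
theorem exists_norm_padicLog_le (X : WeierstrassCurve ℚ_[p]) [X.IsIntegral ℤ_[p]] [X.IsElliptic] :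
    ∃ C : ℝ, ∀ Q : X.toAffine.Point, ‖Additive.LocalLog.padicLog X Q‖ ≤ C := by
  refine ⟨‖(p : ℚ_[p]) ^ ((2 : ℤ) + padicValNat p (Nat.card (AddCommGroup.torsion X.toAffine.Point)) -
      padicValNat p (X.formalFiltration 2).index)‖, fun Q ↦ ?_⟩
  have hQ : Additive.LocalLog.padicLog X Q ∈ (Additive.LocalLog.padicLog X).range := ⟨Q, rfl⟩
  rw [Additive.LocalLog.range_padicLog_eq_span_zpow, Submodule.mem_toAddSubgroup,
    Submodule.mem_span_singleton] at hQ
  obtain ⟨r, hr⟩ := hQ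
  rw [← hr, Algebra.smul_def, PadicInt.algebraMap_apply, norm_mul]
  exact mul_le_of_le_one_left (norm_nonneg _) (PadicInt.norm_le_one r)

/-- A `p`-adic number of norm `≤ C · p^{-k}` for every `k` is `0`. [folklore] -/
theorem eq_zero_of_forall_norm_le_mul_zpow_neg {D : ℚ_[p]} {C : ℝ}
    (h : ∀ k : ℕ, ‖D‖ ≤ C * (p : ℝ) ^ (-(k : ℤ))) : D = 0 := by
  by_contra hD
  have hDpos : 0 < ‖D‖ := norm_pos_iff.mpr hD
  have hC : 0 < C := by
    have h0 := h 0
    rw [Nat.cast_zero, neg_zero, zpow_zero, mul_one] at h0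
    exact hDpos.trans_le h0
  have hp1 : (1 : ℝ) < p := by exact_mod_cast (Fact.out : p.Prime).one_lt
  obtain ⟨k, hk⟩ := exists_pow_lt_of_lt_one (div_pos hDpos hC) (inv_lt_one_of_one_lt₀ hp1)
  have h1 := h k
  rw [zpow_neg, zpow_natCast, ← inv_pow] at h1
  have h2 : C * ((p : ℝ)⁻¹) ^ k < ‖D‖ := by
    calc C * ((p : ℝ)⁻¹) ^ k < C * (‖D‖ / C) := mul_lt_mul_of_pos_left hk hC
      _ = ‖D‖ := mul_div_cancel₀ _ hC.ne'
  exact absurd (h1.trans_lt h2) (lt_irrefl _)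

end Local

/-! ## §3 LOG-HOM: `ℤ_p`-homogeneity of the Kummer logarithm -/

section Main

variable (W : WeierstrassCurve ℚ) [W.IsElliptic] [W.IsGloballyMinimal] (p : ℕ) [Fact p.Prime]
  [ContinuousSMul ℤ_[p] (W.tateModule p)]

/-- The digit approximation `a = c mod p^k ∈ ℕ` of `c ∈ ℤ_p` is `p^k`-close to `c` in `ℚ_p`. [folklore] -/
private theorem norm_coe_sub_appr_le (c : ℤ_[p]) (k : ℕ) :
    ‖(c : ℚ_[p]) - (c.appr k : ℚ_[p])‖ ≤ (p : ℝ) ^ (-(k : ℤ)) := by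
  have h := (PadicInt.norm_le_pow_iff_mem_span_pow _ _).mpr (PadicInt.appr_spec k c)
  rwa [PadicInt.norm_def, PadicInt.coe_sub, PadicInt.coe_natCast] at h

/-- **LOG-HOM — `ℤ_p`-homogeneity / uniqueness of the Kummer logarithm of `loc_p`.** If `c₁ • x = c₂ • y` in
`H¹(ℚ, T_pW)` (`c₁, c₂ ∈ ℤ_p`) and `loc_p x`, `loc_p y` are Kummer classes with logarithms `s`, `t`
(`HasLocPKummerLog`, finite-level currency), then `c₁ s = c₂ t` in `ℚ_p`. PROOF (levelwise). Witnesses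
`(m, Q)` of `x` and `(n, R)` of `y`; at level `p^k` put `a = c₁ mod p^k`, `b = c₂ mod p^k ∈ ℕ`: since
`loc_p mod p^k` kills `p^k H¹` (§1), `loc_p((a·nm)·x) ≡ loc_p(c₁·nm·x) = loc_p(c₂·nm·y) ≡ loc_p((b·nm)·y)`, i.e.
`κ_k((an)·Q) = κ_k((bm)·R)` in `H¹(ℚ_v, W[p^k])`; by the exactness of the local Kummer sequence
(`ker κ_k = p^k E(ℚ_v)`, tree `ker_localKummerMap`, AEC VIII.§2) `(an)·Q − (bm)·R = p^k·S_k` in `E(ℚ_p)`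
(`E(ℚ_p) ≅ E(ℚ_v)`, §2), so `log` of it, `= mn·(a s − b t)`, is `p^k·log S_k`, of norm `≤ C·p^{-k}` (`log` is
bounded on `E(ℚ_p)`, §2); with `|c₁ − a|, |c₂ − b| ≤ p^{-k}` this bounds `|mn·(c₁ s − c₂ t)| ≤ C'·p^{-k}` for
every `k`, whence `c₁ s = c₂ t` (`mn ≠ 0`). This is the content of «`log : H¹_f(ℚ_p, V) = E(ℚ_p) ⊗ ℚ_p → ℚ_p`
is a (`ℤ_p`-linear) homomorphism» (Bloch–Kato Ex. 3.11) in the tree's finite-level currency.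
[cite: BlochKato1990, Def. 3.10 and Ex. 3.11] [cite: SilvermanAEC2009, VIII.§2 (Kummer sequence), IV.6.4 and VII.6.3 (the logarithm)]
[cite: Kato2004Asterisque, §13.8 (p. 228) and §14.14 (14.14.1) (p. 243)] -/
theorem hasLocPKummerLog_smul_eq {x y : H1 (tateRep W p) ⊤} {c₁ c₂ : ℤ_[p]} {s t : ℚ_[p]}
    (hxy : c₁ • x = c₂ • y) (hx : HasLocPKummerLog W p x s) (hy : HasLocPKummerLog W p y t) :
    (c₁ : ℚ_[p]) * s = (c₂ : ℚ_[p]) * t := by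
  obtain ⟨m, Q, hm, hkx, hlogQ⟩ := hx
  obtain ⟨n, R, hn, hky, hlogR⟩ := hy
  obtain ⟨C, hC⟩ := exists_norm_padicLog_le p (W.baseChange ℚ_[p])
  have hlogQ' : Additive.LocalLog.padicLog (W.baseChange ℚ_[p]) Q = (m : ℚ_[p]) * s := by
    rw [← padicLogLocal_eq_padicLog, hlogQ]
  have hlogR' : Additive.LocalLog.padicLog (W.baseChange ℚ_[p]) R = (n : ℚ_[p]) * t := by
    rw [← padicLogLocal_eq_padicLog, hlogR]
  have hmn : ((m * n : ℕ) : ℚ_[p]) ≠ 0 := Nat.cast_ne_zero.mpr (Nat.mul_ne_zero hm hn)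
  -- the estimate at level `p^k`
  have key : ∀ k : ℕ,
      ‖((m * n : ℕ) : ℚ_[p]) * ((c₁.appr k : ℚ_[p]) * s - (c₂.appr k : ℚ_[p]) * t)‖ ≤
        C * (p : ℝ) ^ (-(k : ℤ)) := by
    intro k
    -- (1) the two classes `c₁ • (nm • x) = c₂ • (nm • y)` seen modulo `p^k` through the digit approximations
    have hmid : c₁ • ((n * m) • x) = c₂ • ((n * m) • y) := by
      rw [smul_comm c₁, hxy, smul_comm]
    have h1 : locModPk W p k ((c₁.appr k * (n * m)) • x) = locModPk W p k ((c₂.appr k * (n * m)) • y) := by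
      rw [mul_nsmul', mul_nsmul' y, ← locModPk_smul_eq_locModPk_appr_smul, hmid,
        locModPk_smul_eq_locModPk_appr_smul]
    have hax : (c₁.appr k * (n * m)) • x = (c₁.appr k * n) • (m • x) := by
      rw [← mul_assoc, mul_nsmul']
    have hby : (c₂.appr k * (n * m)) • y = (c₂.appr k * m) • (n • y) := by
      rw [mul_comm n m, ← mul_assoc, mul_nsmul']
    -- (2) hence the level-`p^k` Kummer classes of `(an) • Q` and `(bm) • R` agree
    have h2 : W.localKummerMap ((primePlace p).adicCompletion ℚ)
          (pow_ne_zero k (Int.natCast_ne_zero.mpr (Fact.out : p.Prime).ne_zero))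
          ((c₁.appr k * n) • WeierstrassCurve.Affine.Point.map (padicToAdic p) Q) =
        W.localKummerMap ((primePlace p).adicCompletion ℚ)
          (pow_ne_zero k (Int.natCast_ne_zero.mpr (Fact.out : p.Prime).ne_zero))
          ((c₂.appr k * m) • WeierstrassCurve.Affine.Point.map (padicToAdic p) R) := by
      rw [map_nsmul, map_nsmul, ← hkx k, ← hky k, ← map_nsmul, ← map_nsmul, ← hax, ← hby, h1]
    -- (3) exactness of the local Kummer sequence: the difference is a `p^k`-multiple in `E(ℚ_v)`, hence in `E(ℚ_p)`
    have h3 : (c₁.appr k * n) • WeierstrassCurve.Affine.Point.map (padicToAdic p) Q -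
        (c₂.appr k * m) • WeierstrassCurve.Affine.Point.map (padicToAdic p) R ∈
        (W.localKummerMap ((primePlace p).adicCompletion ℚ)
          (pow_ne_zero k (Int.natCast_ne_zero.mpr (Fact.out : p.Prime).ne_zero))).ker := by
      rw [AddMonoidHom.mem_ker, map_sub, sub_eq_zero, h2]
    -- (`CharZero ℚ_v` is passed explicitly: as a local instance it would let `DivisionRing.toRatAlgebra`
    -- pre-empt the completion's `ℚ`-algebra structure in the elaboration of `E(ℚ_v)`)
    rw [@WeierstrassCurve.ker_localKummerMap ℚ _ W _ _ _ _ _ _ (charZero_adicCompletion _),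
      AddMonoidHom.mem_range] at h3
    obtain ⟨S, hS⟩ := h3
    obtain ⟨S₀, rfl⟩ := exists_map_padicToAdic_eq W p S
    rw [zsmulAddGroupHom_apply, ← map_zsmul, ← map_nsmul, ← map_nsmul, ← map_sub] at hS
    have hS₀ : ((p : ℤ) ^ k) • S₀ = (c₁.appr k * n) • Q - (c₂.appr k * m) • R :=
      WeierstrassCurve.Affine.Point.map_injective (padicToAdic p) hS
    -- (4) logarithms: `mn (a s - b t) = p^k · log S₀`, and `log` is bounded
    have hlog := congrArg (Additive.LocalLog.padicLog (W.baseChange ℚ_[p])) hS₀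
    rw [map_zsmul, map_sub, map_nsmul, map_nsmul, hlogQ', hlogR', zsmul_eq_mul, nsmul_eq_mul,
      nsmul_eq_mul] at hlog
    have hT : ((m * n : ℕ) : ℚ_[p]) * ((c₁.appr k : ℚ_[p]) * s - (c₂.appr k : ℚ_[p]) * t) =
        (p : ℚ_[p]) ^ k * Additive.LocalLog.padicLog (W.baseChange ℚ_[p]) S₀ := by
      have e : (((p : ℤ) ^ k : ℤ) : ℚ_[p]) = (p : ℚ_[p]) ^ k := by push_cast; rfl
      rw [← e, hlog]; push_cast; ring
    rw [hT, norm_mul, Padic.norm_p_pow, mul_comm]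
    exact mul_le_mul_of_nonneg_right (hC S₀) (zpow_nonneg (Nat.cast_nonneg _) _)
  -- the limit `k → ∞`
  have hD : ((m * n : ℕ) : ℚ_[p]) * ((c₁ : ℚ_[p]) * s - (c₂ : ℚ_[p]) * t) = 0 := by
    refine eq_zero_of_forall_norm_le_mul_zpow_neg p
      (C := C + ‖((m * n : ℕ) : ℚ_[p])‖ * (‖s‖ + ‖t‖)) fun k ↦ ?_
    have hsplit : ((m * n : ℕ) : ℚ_[p]) * ((c₁ : ℚ_[p]) * s - (c₂ : ℚ_[p]) * t) =
        ((m * n : ℕ) : ℚ_[p]) * ((c₁.appr k : ℚ_[p]) * s - (c₂.appr k : ℚ_[p]) * t) +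
          ((m * n : ℕ) : ℚ_[p]) * (((c₁ : ℚ_[p]) - (c₁.appr k : ℚ_[p])) * s -
            ((c₂ : ℚ_[p]) - (c₂.appr k : ℚ_[p])) * t) := by ring
    have hk0 : (0 : ℝ) ≤ (p : ℝ) ^ (-(k : ℤ)) := zpow_nonneg (Nat.cast_nonneg _) _
    rw [hsplit]
    calc _ ≤ ‖((m * n : ℕ) : ℚ_[p]) * ((c₁.appr k : ℚ_[p]) * s - (c₂.appr k : ℚ_[p]) * t)‖ +
          ‖((m * n : ℕ) : ℚ_[p]) * (((c₁ : ℚ_[p]) - (c₁.appr k : ℚ_[p])) * s -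
            ((c₂ : ℚ_[p]) - (c₂.appr k : ℚ_[p])) * t)‖ := norm_add_le _ _
      _ ≤ C * (p : ℝ) ^ (-(k : ℤ)) +
          ‖((m * n : ℕ) : ℚ_[p])‖ * ((p : ℝ) ^ (-(k : ℤ)) * ‖s‖ + (p : ℝ) ^ (-(k : ℤ)) * ‖t‖) := by
        refine add_le_add (key k) ?_
        rw [norm_mul]
        refine mul_le_mul_of_nonneg_left ((norm_sub_le _ _).trans (add_le_add ?_ ?_)) (norm_nonneg _)
        · rw [norm_mul]
          exact mul_le_mul_of_nonneg_right (norm_coe_sub_appr_le p c₁ k) (norm_nonneg _)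
        · rw [norm_mul]
          exact mul_le_mul_of_nonneg_right (norm_coe_sub_appr_le p c₂ k) (norm_nonneg _)
      _ = (C + ‖((m * n : ℕ) : ℚ_[p])‖ * (‖s‖ + ‖t‖)) * (p : ℝ) ^ (-(k : ℤ)) := by ring
  have h := (mul_eq_zero.mp hD).resolve_left hmn
  rwa [sub_eq_zero] at h

/-- **LOG-HOM in the DISPLAYED shape** of `KatoDescentRankOneCountContraOfFacts.rankOneCountReading_contra_of_facts`
(hypothesis `hLogHom`, display (5)): for every globally minimal elliptic `W/ℚ` and every prime `p`, with the
`letI` term `TateModule.continuousSMul_padicInt`. [cite: BlochKato1990, Def. 3.10 and Ex. 3.11] -/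
theorem logHom_display :
    ∀ (W : WeierstrassCurve ℚ) [W.IsElliptic] [W.IsGloballyMinimal] (p : ℕ) [Fact p.Prime],
      letI : ContinuousSMul ℤ_[p] (W.tateModule p) := TateModule.continuousSMul_padicInt
      ∀ (x y : H1 (tateRep W p) ⊤) (c₁ c₂ : ℤ_[p]) (s t : ℚ_[p]), c₁ • x = c₂ • y →
        HasLocPKummerLog W p x s → HasLocPKummerLog W p y t → (c₁ : ℚ_[p]) * s = (c₂ : ℚ_[p]) * t := by
  intro W _ _ p _
  letI : ContinuousSMul ℤ_[p] (W.tateModule p) := TateModule.continuousSMul_padicInt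
  intro x y c₁ c₂ s t hxy hx hy
  exact hasLocPKummerLog_smul_eq W p hxy hx hy

/-- **Uniqueness of the Kummer logarithm**: `HasLocPKummerLog W p x s → HasLocPKummerLog W p x t → s = t`.
[cite: BlochKato1990, Def. 3.10 and Ex. 3.11] -/
theorem HasLocPKummerLog.unique {x : H1 (tateRep W p) ⊤} {s t : ℚ_[p]}
    (hs : HasLocPKummerLog W p x s) (ht : HasLocPKummerLog W p x t) : s = t := by
  have h := hasLocPKummerLog_smul_eq W p (c₁ := 1) (c₂ := 1) (x := x) (y := x) rfl hs ht
  simpa using h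

/-- **A `ℤ_p`-torsion class has Kummer logarithm `0`**: `c • x = 0` with `c ≠ 0` and
`HasLocPKummerLog W p x s` ⟹ `s = 0` (the zero class has logarithm `0`: witness `(1, 0)`).
[cite: BlochKato1990, Def. 3.10 and Ex. 3.11] -/
theorem HasLocPKummerLog.eq_zero_of_smul_eq_zero {x : H1 (tateRep W p) ⊤} {c : ℤ_[p]} {s : ℚ_[p]}
    (hc : c ≠ 0) (hcx : c • x = 0) (hs : HasLocPKummerLog W p x s) : s = 0 := by
  have h0 : HasLocPKummerLog W p (0 : H1 (tateRep W p) ⊤) 0 := by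
    refine ⟨1, 0, one_ne_zero, fun k ↦ ?_, ?_⟩
    · rw [nsmul_zero, map_zero, map_zero, map_zero]
    · rw [mul_zero, padicLogLocal_eq_padicLog, map_zero]
  have h := hasLocPKummerLog_smul_eq W p (c₁ := c) (c₂ := 1) (y := 0) (by rw [hcx, smul_zero]) hs h0
  rw [mul_zero, mul_eq_zero] at h
  exact h.resolve_left (PadicInt.coe_ne_zero.mpr hc)

end Main

/-! ## §4 Stub 3 from three named facts and THREE displayed schemata (display (5) LOG-HOM discharged by §3) -/

section Stub

/-- **Stub 3 `stub_rankOneCountReadingKato` REDUCED FURTHER**: `TorsionFree.RankOneCountReading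
IsKatoZetaDescentDatumOfContra Kato2004.PRRatio` (verbatim the stub's type in both v4 skeletons) from
Gross–Zagier–Kolyvagin, `Kato2004.finite_descentCokernel_of_rankOne`, `IsNewformOf.level_eq_conductorNorm` and the
THREE displayed schemata LOG-EX (4), PR-INV (6), COUNT (7) of `KatoDescentRankOneCountContraOfFacts.lean` — the
fourth, LOG-HOM (5), being the theorem `logHom_display` of §3. Conditional reduction; closes nothing by itself.
[cite: Kato2004Asterisque, §13.9–13.12 (pp. 229–231), §14.14 (p. 243) and Prop. 14.16 (p. 244)]
[cite: BlochKato1990, Def. 3.10 and Ex. 3.11] [cite: BurnsKuriharaSano2019, Thm. 7.3 and Thm. 7.8 (d)] -/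
theorem rankOneCountReading_contra_of_facts_of_logHom
    (hGZK : rank_eq_analyticRank_of_analyticRank_le_one)
    (hfd : Kato2004.finite_descentCokernel_of_rankOne)
    (hlev : ∀ (N : ℕ) [NeZero N], IsNewformOf.level_eq_conductorNorm (N := N))
    (hLogEx : ∀ (W : WeierstrassCurve ℚ) [W.IsElliptic] [W.IsGloballyMinimal] (p : ℕ) [Fact p.Prime],
      letI : ContinuousSMul ℤ_[p] (W.tateModule p) := TateModule.continuousSMul_padicInt
      ∀ (κ : ZpExtension ℚ p) (γ : absoluteGaloisGroup ℚ), κ.IsCyclotomic → κ.IsTopGenerator γ →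
        W.analyticRank = 1 → ∀ (I : IwasawaH1Data W p κ γ) (x : I.H),
          ∃ t : ℚ_[p], HasLocPKummerLog W p (layerZeroToTop W p κ (I.proj 0 x)) t)
    (hPRinv : ∀ (W : WeierstrassCurve ℚ) [W.IsElliptic] [W.IsGloballyMinimal] (p : ℕ) [Fact p.Prime]
      (ℒ₁ ℒ₂ : ℚ_[p]), Kato2004.PRRatio W p ℒ₁ → Kato2004.PRRatio W p ℒ₂ → ∃ w : ℚ_[p], ‖w‖ = 1 ∧ ℒ₂ = w * ℒ₁)
    (hCount : ∀ (W : WeierstrassCurve ℚ) [W.IsElliptic] [W.IsGloballyMinimal] (p : ℕ) [Fact p.Prime],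
      letI : ContinuousSMul ℤ_[p] (W.tateModule p) := TateModule.continuousSMul_padicInt
      ∀ (κ : ZpExtension ℚ p) (γ : absoluteGaloisGroup ℚ), κ.IsCyclotomic → κ.IsTopGenerator γ →
        ∀ (I : IwasawaH1Data W p κ γ) (J : IwasawaH2Data W p κ γ I) (x : I.H) (s : ℚ_[p])
          (P : W.toAffine.Point),
          W.analyticRank = 1 → p ≠ 2 → Addv W p → 0 ≤ padicValRat p W.j → ¬ p ∣ W.torsionOrder →
          Finite W.sha →
          (∀ (Y : W.FineSelmerDualData κ γ⁻¹) (𝔮 : PrimeSpectrum (IwasawaAlgebra p)), 𝔮.asIdeal.height = 1 →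
            Module.lengthAt (IwasawaAlgebra p) J.H2 𝔮 = Module.lengthAt (IwasawaAlgebra p) Y.X 𝔮) →
          (∀ Q : W.toAffine.Point, ∃ n : ℤ, IsOfFinAddOrder (Q - n • P)) →
          HasLocPKummerLog W p (layerZeroToTop W p κ (I.proj 0 x)) s →
          (s ≠ 0 ↔ Nat.card (J.A ⧸ (IwasawaAlgebra p) ∙ J.ι (Submodule.Quotient.mk x)) ≠ 0) ∧
            ∀ m : ℕ, Nat.card (J.A ⧸ (IwasawaAlgebra p) ∙ J.ι (Submodule.Quotient.mk x)) =
                p ^ m * Nat.card (coinvariants p J.H2) →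
              s.valuation = (m : ℤ) + padicValNat p (Nat.card (AddCommGroup.primaryComponent W.sha p)) +
                padicValNat p W.tamagawaProduct +
                2 * (padicLogLocal W p
                  (WeierstrassCurve.Affine.Point.map (W' := W.toAffine) (S := ℚ) (Algebra.ofId ℚ ℚ_[p]) P)).valuation) :
    TorsionFree.RankOneCountReading IsKatoZetaDescentDatumOfContra Kato2004.PRRatio :=
  rankOneCountReading_contra_of_facts hGZK hfd hlev hLogEx logHom_display hPRinv hCount

end Stub

end Summit.BirchSwinnertonDyer.Rank1Residual.Additive.ContraCount
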